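import Summits.Langlands.Langlands.Theorems.IrreducibilityBySelfDualityReciprocityUpToIrreducibilityLadicFiniteInertia
import Summits.Langlands.Langlands.Theorems.IrreducibilityBySelfDualityReciprocityUpToIrreducibilityWeilDeligneBridge
import Literature.NumberTheory.GaloisRepresentations.InertiaCharacter
import HarnessLib

/-!
# Line `Sketch` for the crux `ReciprocityUpToIrreducibility` (item stmt-Langlands-14328), continuation c7:
# on the FINITE-INERTIA sector the Grothendieck–Deligne recipe returns `(ρ|_{W_F}, 0)` itself

Support file (closes nothing; continuation lead c7, stub S-D of wave N7).

Statement (`stub_eq_ofRep_of_isWeilDeligneOfLadic_of_isContinuousRep`): for a framed representation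
`ρ : Γ_F → GL_n(E)` of the absolute Galois group of a non-archimedean local field `F` (`E` a field of
characteristic `0`) whose restriction `ρ|_{W_F}` is continuous for the discrete topology
(`hc : WeilGroup.IsContinuousRep (ρ.weilRestrict F)`: trivial on some open subgroup `U' ≤ I_F`), every
Weil–Deligne representation `r` attached to `ρ.toWeilGroupHom` by the recipe `IsWeilDeligneOfLadic`
IS `(ρ|_{W_F}, N = 0)`: `r = WeilDeligneRep.ofRep (ρ.weilRestrict F) hc` — the finite-inertia
generalisation of c4's unramified `eq_ofRep_weilRestrict_of_isWeilDeligneOfLadic`, and the converse of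
S-A (`stub_isWeilDeligneOfLadic_ofRep_of_isContinuousRep`).

Proof.  (1) `N = 0` (`N_eq_zero_of_isWeilDeligneOfLadic_of_forall_eq_one`): the recipe provides
`t : I_F →* Multiplicative E`, an open `U ≤ I_F` and `u₀ ∈ U` with `t u₀ ≠ 1` and
`ρ(u) = exp(t(u) • N)` on `U`; `I_F` is compact, so `u₀ ^ k ∈ U'` for some `k ≥ 1`
(`WeilGroup.exists_pow_mem_of_isOpen`), where `ρ(u₀ ^ k) = 1`; as `t(u₀ ^ k) = k • t(u₀) ≠ 0` in
characteristic `0`, `exp((k • t u₀) • N) = 1` forces `N = 0` (`Matrix.eq_zero_of_exp_smul_eq_one`,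
injectivity of `exp` on nilpotent matrices).  (2) With `N = 0` the last clause of the recipe reads
`[r.ρ(Φ^m u)] = ρ(Φ^m u)`, and `W_F = Φ^ℤ · I_F` (`WeilGroup.zpow_deg_mul_mem_inertia`), so
`[r.ρ w] = ρ(w) = [ρ|_{W_F}(w)]` for every `w` (c5's
`toMatrix'_eq_of_isWeilDeligneOfLadic_of_N_eq_zero_wdBridge`, `toMatrix'_weilRestrict`).  (3) Two
Weil–Deligne representations with the same `ρ` and the same `N` are equal (proof irrelevance).
Lemmas used: `toWeilGroupHom_eq_one_of_weilRestrict_eq_one` (S-A's file), `toMatrix'_weilRestrict`,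
`toMatrix'_eq_of_isWeilDeligneOfLadic_of_N_eq_zero_wdBridge`, `WeilGroup.exists_pow_mem_of_isOpen`,
`Matrix.eq_zero_of_exp_smul_eq_one`.  No definitions; std axioms; no named fact assumed.
-/

noncomputable section

set_option linter.dupNamespace false -- project-wide option (lakefile weak.linter.dupNamespace); `Summit.Langlands.Langlands` is the mandated namespace

open scoped MatrixGroups Matrix NumberField Classical
open Filter IsDedekindDomain Field
open Literature.NumberTheory.Automorphic Literature.NumberTheory.GaloisRepresentations
open Literature.NumberTheory.PAdicHodge
open Summit.Langlands

namespace Summit.Langlands.Langlands.Theorems.ReciprocityUpToIrreducibility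

section Local

variable {F : Type} [Field F] [ValuativeRel F] [TopologicalSpace F] [IsNonarchimedeanLocalField F]
  {E : Type*} [Field E] [CharZero E] {n : ℕ}

/-- **`N = 0` as soon as `ρW` kills an open subgroup of `W_F`.**  If `r = (ρ_WD, N)` is attached to
`ρW` by the Grothendieck–Deligne recipe and `ρW = 1` on an open subgroup `V`, then `N = 0`: the
recipe's `u₀ ∈ U` with `t u₀ ≠ 1` has a power `u₀ ^ k ∈ V`, `k ≥ 1` (`I_F` is compact,
`WeilGroup.exists_pow_mem_of_isOpen`), where `exp((k • t u₀) • N) = ρW(u₀ ^ k) = 1` with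
`k • t u₀ ≠ 0` in characteristic `0`. [cite: DeligneAntwerpII1973, §8.4.2]
[cite: TateCorvallis1979, (4.2.1)] -/
theorem N_eq_zero_of_isWeilDeligneOfLadic_of_forall_eq_one {ρW : WeilGroup F →* GL (Fin n) E}
    {r : WeilDeligneRep F E (Fin n → E)} (h : IsWeilDeligneOfLadic ρW r)
    {V : Subgroup (WeilGroup F)} (hVo : IsOpen (V : Set (WeilGroup F)))
    (hker : ∀ u ∈ V, ρW u = 1) : r.N = 0 := by
  obtain ⟨t, U, Φ, -, -, -, ⟨u₀, hu₀U, ht₀⟩, h2, -⟩ := h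
  obtain ⟨k, hk, hkV⟩ := WeilGroup.exists_pow_mem_of_isOpen V hVo u₀.2
  have hNnil : IsNilpotent (LinearMap.toMatrix' r.N) :=
    r.isNilpotent_N.map LinearMap.toMatrixAlgEquiv'
  have ht₀a : (t u₀).toAdd ≠ 0 := fun h => ht₀ (by rw [← ofAdd_toAdd (t u₀), h, ofAdd_zero])
  have hka : (t (u₀ ^ k)).toAdd ≠ 0 := by
    rw [map_pow, toAdd_pow, nsmul_eq_mul]
    exact mul_ne_zero (Nat.cast_ne_zero.mpr hk.ne') ht₀a
  have hexp := h2 (u₀ ^ k) (by simpa using U.pow_mem hu₀U k)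
  rw [Subgroup.coe_pow, hker _ hkV, Units.val_one] at hexp
  exact (LinearEquiv.map_eq_zero_iff LinearMap.toMatrix').mp
    (Matrix.eq_zero_of_exp_smul_eq_one hNnil hka hexp.symm)

variable [TopologicalSpace E]

/-- **On the finite-inertia sector the recipe returns `(ρ|_{W_F}, 0)` itself.**  If `ρ|_{W_F}` is
continuous for the discrete topology (trivial on an open `U' ≤ I_F`) and `r` is attached to
`ρ.toWeilGroupHom` by `IsWeilDeligneOfLadic`, then `r = WeilDeligneRep.ofRep (ρ|_{W_F}) hc`: `N = 0`
(`N_eq_zero_of_isWeilDeligneOfLadic_of_forall_eq_one` on `U'`), `[r.ρ w] = ρ(w) = [ρ|_{W_F}(w)]` for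
all `w` (c5's `toMatrix'_eq_of_isWeilDeligneOfLadic_of_N_eq_zero_wdBridge`, `toMatrix'_weilRestrict`),
and a Weil–Deligne representation is determined by `(ρ, N)`. [cite: DeligneAntwerpII1973, §8.4.2]
[cite: TateCorvallis1979, (4.1.3)–(4.2.1)] -/
theorem eq_ofRep_of_isWeilDeligneOfLadic_of_isContinuousRep
    (ρ : FramedRep (absoluteGaloisGroup F) E n) (hc : WeilGroup.IsContinuousRep (ρ.weilRestrict F))
    {r : WeilDeligneRep F E (Fin n → E)} (hlad : IsWeilDeligneOfLadic ρ.toWeilGroupHom r) :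
    r = WeilDeligneRep.ofRep (ρ.weilRestrict F) hc := by
  obtain ⟨U', -, hU'o, hker⟩ := id hc
  have hN : r.N = 0 := N_eq_zero_of_isWeilDeligneOfLadic_of_forall_eq_one hlad hU'o
    fun u hu => toWeilGroupHom_eq_one_of_weilRestrict_eq_one ρ (hker u hu)
  have hρW : ∀ w, r.ρ w = ρ.weilRestrict F w := fun w =>
    LinearMap.toMatrix'.injective
      ((toMatrix'_eq_of_isWeilDeligneOfLadic_of_N_eq_zero_wdBridge hlad hN w).trans
        (toMatrix'_weilRestrict ρ w).symm)
  cases r with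
  | mk ρr hc' N hnil hconj =>
    have h1 : ρr = ρ.weilRestrict F := MonoidHom.ext fun w => hρW w
    have h2 : N = 0 := hN
    subst h1 h2
    rfl

end Local

/-- **Registered stub `stub_eq_ofRep_of_isWeilDeligneOfLadic_of_isContinuousRep` of line `Sketch` (crux
stmt-Langlands-14328, c7 wave N7)**: closed form of `eq_ofRep_of_isWeilDeligneOfLadic_of_isContinuousRep`.
For `ρ : Γ_F → GL_n(E)` with `ρ|_{W_F}` continuous for the discrete topology (`hc`), every Weil–Deligne
representation `r` attached to `ρ.toWeilGroupHom` by the Grothendieck–Deligne recipe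
`IsWeilDeligneOfLadic` equals `(ρ|_{W_F}, N = 0)` = `WeilDeligneRep.ofRep (ρ.weilRestrict F) hc`
(`N = 0` at a power `u₀ ^ k` of the recipe's `u₀` lying in the open subgroup killed by `ρ|_{W_F}` —
compactness of `I_F`, injectivity of `exp` on nilpotents, characteristic `0`; then `[r.ρ w] = ρ(w)` on
`W_F = Φ^ℤ · I_F`). [cite: DeligneAntwerpII1973, §8.4.2] [cite: TateCorvallis1979, (4.1.3)–(4.2.1)] -/
theorem stub_eq_ofRep_of_isWeilDeligneOfLadic_of_isContinuousRep :
    ∀ (F : Type) [Field F] [ValuativeRel F] [TopologicalSpace F] [IsNonarchimedeanLocalField F]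
      (E : Type) [Field E] [CharZero E] [TopologicalSpace E] (n : ℕ)
      (ρ : FramedRep (Field.absoluteGaloisGroup F) E n) (hc : WeilGroup.IsContinuousRep (ρ.weilRestrict F))
      (r : WeilDeligneRep F E (Fin n → E)),
      IsWeilDeligneOfLadic ρ.toWeilGroupHom r → r = WeilDeligneRep.ofRep (ρ.weilRestrict F) hc :=
  fun _ _ _ _ _ _ _ _ _ _ ρ hc _ hlad => eq_ofRep_of_isWeilDeligneOfLadic_of_isContinuousRep ρ hc hlad

end Summit.Langlands.Langlands.Theorems.ReciprocityUpToIrreducibility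

end
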